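import Summits.Ventures.CertifiedManyBodySolver.Certificates.SymRungV0core.Defs2

/-!
# Rung V = v0′ — shard fact 6 of the reshaped partition `sizes2 = [1,25,2,27,2]` (Gram group 2b (R-blocks 57–84)): the tree's box-canonical normal form of the shard equals the sub-partial `Pg2b`.
One `native_decide` (≈ half of a J = 3 group's products; sized for the gate's 600-s accept elaboration).  No bound of record moves by this module (#529 −0.8295699476 stays the certified row); the rung value −0.8942613 is 0.064 BELOW the −83/100 edge (stmt-Ventures-22024 NOT closed); computational grade (`native_decide`); no summit or crux statement is proved here; nothing here predicts superconductivity.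
-/

namespace Summit.Ventures.CertifiedManyBodySolver.Certificates.SymRungV0core

open Summit.Ventures.CertifiedManyBodySolver.Theorems.SymReplay

/-- **Shard fact 6 (reshaped)**: `shardOKRGB cert c sizes2 lo hi 6 Pg2b`. -/
theorem fact3b : shardOKRGB cert cpar sizes2 lo hi 6 Pg2b = true := by native_decide

end Summit.Ventures.CertifiedManyBodySolver.Certificates.SymRungV0core
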